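import Literature.Computability.QuantumComplexity.PauliPathIntegral
import HarnessLib

/-!
# Legal Pauli paths: the vanishing of illegal path contributions (Aharonov–Gao–Landau–Liu–Vazirani 2023, Definition 6, Lemma 5, Lemma 4 items 1–2)

Topic `Literature/Computability/QuantumComplexity`; sequel of `PauliPathIntegral.lean` (pub-qadeq lane,
rows E-01…E-10: the sparsity half of the noisy-RCS easiness argument — "most low-Hamming-weight
Feynman paths have 0 contribution to the path integral").

HONEST FRAMING: instance-level adjudication of specific advantage claims; no claim about BQP vs
BPP or the summit. Deterministic finite identities about the path contributions of
`PauliPathIntegral.lean`; nothing about counting legal paths (Lemmas 6–8), anti-concentration or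
running times.

## Source

D. Aharonov, X. Gao, Z. Landau, Y. Liu, U. Vazirani, STOC 2023 = arXiv:2211.03999 [AharonovEtAl2023]
(tex chunks p0008–p0011 of `lit read arxiv:2211.03999`):

* Definition 6 (Legal Pauli path): "a Pauli path `s = (s_0, s_1, …, s_d)` is legal if … For all
  2-qubit gates in the circuit, its input and output Paulis are either both `II`, or both not `II`"
  and "`s_0` and `s_d` contains only `I` and `Z`".
* Lemma 5: "Any illegal Pauli path `s` gives `f(C,s,x) = 0` for any `C` and `x`." Proof: the second
  condition — "`⟨⟨x|s⟩⟩ = Tr(|x⟩⟨x|·s) = 0` for `s ∉ {I/√2, Z/√2}^{⊗n}`"; the first — "the transition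
  amplitude contributed by `U` equals 0 due to the fact that unitary channel is trace preserving, i.e.
  `⟨⟨p|𝒰|q⟩⟩ = Tr(p U q U†) = 0` if `p = I⊗I/2, q ≠ I⊗I/2`, or `p ≠ I⊗I/2, q = I⊗I/2`".
* Lemma 4 (Total Fourier weight), items 1–2: "`W_0 = 1`", "`W_k = 0`, `0 < k ≤ d`"; proof: "`W_0 = 1`
  corresponds to the unique all-identity path. Let `s` be a Pauli path of Hamming weight
  `k = |s| ∈ (0, d]`. Then there exists a 2-qubit gate `U` that contributes a transition amplitude
  `⟨⟨p|𝒰|q⟩⟩` to `f(C,s,0ⁿ)`, where either `p` is identity and `q` is non-identity, or vice versa."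

## What is formalised (layer granularity)

`PauliPathIntegral.lean` models a circuit by arbitrary LAYER matrices `U_t` on the register; the
first legality condition is therefore stated per layer — the input and output strings of a layer are
both the identity string or both not (`PauliPath.LayerLegal`). TODO(general form): the printed
per-gate condition (restriction of `s_t, s_{t+1}` to each 2-qubit gate's wires) needs the gate
structure of a layer and the partial-trace identity `Tr_{gate}`; the layer form is its special case
"one gate = the whole layer" and is what Lemma 4 items 1–2 use.

* `trace_pauliString_eq_zero` (`Tr S = 0` for `S ≠ I…I`), `transAmp_const_I_left/right_eq_zero`
  (Lemma 5, first condition, for layers with `U U† = 1` / `U† U = 1`),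
  `pauliString_apply_self_eq_zero` / `trace_proj_mul_pauliString_eq_zero` (second condition:
  `⟨x|S|x⟩ = 0` as soon as some letter of `S` is `X` or `Y`);
* `pathCoeff_eq_zero_of_not_layerLegal`, `pathCoeff_eq_zero_of_mem_XY_last/first` (Lemma 5);
* `pathWeight_eq_zero_or_lt_of_pathCoeff_ne_zero` (Lemma 4 item 2: a contributing path is the
  all-identity path or has weight `≥ d+1`), `pathCoeff_const_I_proj` and `fourierWeight_zero`
  (item 1: the all-identity path contributes exactly `2^{-n}`, so `2^{2n} f(C,I…I,x)² = 1`).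

Counting (§3.2, first paragraph — "n(d+1) locations … binom(n(d+1), ℓ) … 3^ℓ factor"):
`card_filter_weight_eq` (functions with exactly `k` non-default values number `binom(N,k)(|A|−1)^k`),
`pathWeight_eq_card`, `card_filter_pathWeight_eq` (paths of weight `k`: `binom(n(d+1),k)·3^k`),
`card_filter_pathWeight_le` (paths of weight `≤ ℓ`: `Σ_{k≤ℓ} binom(n(d+1),k) 3^k`, the term count of
the truncated sum `q̄`).

## References

* [AharonovEtAl2023] D. Aharonov, X. Gao, Z. Landau, Y. Liu, U. Vazirani, *A polynomial-time classical
  algorithm for noisy random circuit sampling*, STOC 2023, 945–957, arXiv:2211.03999 — §2 Lemma 4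
  (items 1–2 and their proof), §3.2 Definition 6, Lemma 5 (with proof).
-/

noncomputable section

open Matrix Finset

namespace Literature.Computability.QuantumComplexity

namespace PauliPath

variable {ι : Type*} [Fintype ι] [DecidableEq ι]

/-! ### Traces of Pauli strings and the first legality condition -/

/-- A non-identity Pauli string is traceless: `Tr S = 0` for `S ≠ (I,…,I)` (and `Tr I…I = 2^{|ι|}`).
[cite: AharonovEtAl2023, §3.2 (proof of Lemma 5: "unitary channel is trace preserving")] -/
theorem trace_pauliString_eq_zero {S : ι → Pauli} (hS : S ≠ fun _ => Pauli.I) :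
    (pauliString S).trace = 0 := by
  have h := trace_pauliString_mul_pauliString S (fun _ => Pauli.I)
  rwa [pauliString_const_I, Matrix.mul_one, if_neg hS] at h

/-- **Lemma 5, first condition, identity in / non-identity out**: for a layer with `U U† = 1`,
`Tr(T · U ℰ^{⊗n}(I…I) U†) = Tr T = 0` when `T ≠ I…I`.
[cite: AharonovEtAl2023, Lemma 5 (proof: ⟨⟨p|𝒰|q⟩⟩ = 0 if p ≠ II, q = II)] -/
theorem transAmp_const_I_left_eq_zero (γ : ℂ) {U : Matrix (ι → Bool) (ι → Bool) ℂ}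
    (hU : U * Uᴴ = 1) {T : ι → Pauli} (hT : T ≠ fun _ => Pauli.I) :
    transAmp γ U (fun _ => Pauli.I) T = 0 := by
  rw [transAmp, depolarizeAll_pauliString, strWeight_const_I, pow_zero, one_smul, pauliString_const_I,
    Matrix.mul_one, hU, Matrix.mul_one, trace_pauliString_eq_zero hT]

/-- **Lemma 5, first condition, non-identity in / identity out**: for a layer with `U† U = 1`,
`Tr(I…I · U ℰ^{⊗n}(S) U†) = (1−γ)^{|S|} Tr S = 0` when `S ≠ I…I` (the unitary channel is trace
preserving). [cite: AharonovEtAl2023, Lemma 5 (proof: ⟨⟨p|𝒰|q⟩⟩ = 0 if p = II, q ≠ II)] -/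
theorem transAmp_const_I_right_eq_zero (γ : ℂ) {U : Matrix (ι → Bool) (ι → Bool) ℂ}
    (hU : Uᴴ * U = 1) {S : ι → Pauli} (hS : S ≠ fun _ => Pauli.I) :
    transAmp γ U S (fun _ => Pauli.I) = 0 := by
  rw [transAmp, depolarizeAll_pauliString, pauliString_const_I, Matrix.one_mul, Matrix.mul_smul,
    Matrix.smul_mul, Matrix.trace_smul, Matrix.mul_assoc, Matrix.trace_mul_comm, Matrix.mul_assoc, hU,
    Matrix.mul_one, trace_pauliString_eq_zero hS, smul_zero]

/-- Layer-level legality (the first condition of Definition 6 with one gate = the whole layer): at every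
layer the input string and the output string are both the identity string or both not.
[cite: AharonovEtAl2023, Definition 6 (first condition)] -/
def LayerLegal {d : ℕ} (s : Fin (d + 1) → ι → Pauli) : Prop :=
  ∀ t : Fin d, (s t.castSucc = fun _ => Pauli.I) ↔ (s t.succ = fun _ => Pauli.I)

/-- **Lemma 5 (first condition)**: a path that is not layer-legal contributes `0`, for layers that are
unitary (`U U† = 1` and `U† U = 1`), any noise rate, input and read-out.
[cite: AharonovEtAl2023, Lemma 5] -/
theorem pathCoeff_eq_zero_of_not_layerLegal (γ : ℂ) {d : ℕ} {U : Fin d → Matrix (ι → Bool) (ι → Bool) ℂ}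
    (hU : ∀ t, U t ∈ Matrix.unitaryGroup (ι → Bool) ℂ) (ρ O : Matrix (ι → Bool) (ι → Bool) ℂ)
    {s : Fin (d + 1) → ι → Pauli} (hs : ¬ LayerLegal s) : pathCoeff γ U ρ O s = 0 := by
  simp only [LayerLegal, not_forall] at hs
  obtain ⟨t, ht⟩ := hs
  have hzero : transAmp γ (U t) (s t.castSucc) (s t.succ) = 0 := by
    by_cases h1 : s t.castSucc = fun _ => Pauli.I
    · have h2 : s t.succ ≠ fun _ => Pauli.I := fun h2 => ht ⟨fun _ => h2, fun _ => h1⟩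
      rw [h1]
      refine transAmp_const_I_left_eq_zero γ ?_ h2
      simpa only [star_eq_conjTranspose] using Matrix.mem_unitaryGroup_iff.mp (hU t)
    · have h2 : s t.succ = fun _ => Pauli.I := by
        by_contra h2
        exact ht ⟨fun h => absurd h h1, fun h => absurd h h2⟩
      rw [h2]
      refine transAmp_const_I_right_eq_zero γ ?_ h1
      simpa only [star_eq_conjTranspose] using Matrix.mem_unitaryGroup_iff'.mp (hU t)
  rw [pathCoeff, Finset.prod_eq_zero (Finset.mem_univ t) hzero, mul_zero, zero_mul, mul_zero]

/-! ### The second legality condition: basis-state brackets see only `I` and `Z` -/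

omit [Fintype ι] [DecidableEq ι] in
/-- The diagonal entries of `σ_X` and `σ_Y` vanish. [cite: AharonovEtAl2023, Lemma 5 (proof: ⟨x|s|x⟩ = 0 for s ∉ {I,Z}^{⊗n})] -/
theorem mat_apply_self_eq_zero {Q : Pauli} (hQ : Q = Pauli.X ∨ Q = Pauli.Y) (b : Bool) :
    Q.mat b b = 0 := by
  rcases hQ with rfl | rfl <;> cases b <;> simp

omit [DecidableEq ι] in
/-- **Lemma 5, second condition**: `⟨x|S|x⟩ = 0` as soon as some letter of `S` is `X` or `Y`
("`⟨⟨x|s⟩⟩ = Tr(|x⟩⟨x|·s) = 0` for `s ∉ {I/√2, Z/√2}^{⊗n}`"). [cite: AharonovEtAl2023, Lemma 5 (proof, first display)] -/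
theorem pauliString_apply_self_eq_zero {S : ι → Pauli} {i : ι} (hi : S i = Pauli.X ∨ S i = Pauli.Y)
    (x : ι → Bool) : pauliString S x x = 0 := by
  rw [pauliString_eq, tensorAll_apply]
  exact Finset.prod_eq_zero (Finset.mem_univ i) (mat_apply_self_eq_zero hi (x i))

/-- The read-out bracket `Tr(|x⟩⟨x| · ℰ^{⊗n} S)` vanishes when `S` has an `X` or `Y` letter.
[cite: AharonovEtAl2023, Lemma 5 (second condition)] -/
theorem trace_proj_mul_depolarizeAll_eq_zero (γ : ℂ) {S : ι → Pauli} {i : ι}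
    (hi : S i = Pauli.X ∨ S i = Pauli.Y) (x : ι → Bool) :
    (proj x * depolarizeAll γ (pauliString S)).trace = 0 := by
  rw [depolarizeAll_pauliString, Matrix.mul_smul, Matrix.trace_smul, trace_proj_mul,
    pauliString_apply_self_eq_zero hi, smul_zero]

/-- The input bracket `Tr(S · |y⟩⟨y|)` vanishes when `S` has an `X` or `Y` letter.
[cite: AharonovEtAl2023, Lemma 5 (second condition)] -/
theorem trace_pauliString_mul_proj_eq_zero {S : ι → Pauli} {i : ι} (hi : S i = Pauli.X ∨ S i = Pauli.Y)
    (y : ι → Bool) : (pauliString S * proj y).trace = 0 := by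
  rw [Matrix.trace_mul_comm, trace_proj_mul, pauliString_apply_self_eq_zero hi]

/-- **Lemma 5 (second condition, last string)**: if `s_d` has an `X` or `Y` letter, the path contributes
`0` to `p̃(C,x)` (read-out `|x⟩⟨x|`), for any layers, input and noise rate.
[cite: AharonovEtAl2023, Lemma 5] -/
theorem pathCoeff_eq_zero_of_last_mem_XY (γ : ℂ) {d : ℕ} (U : Fin d → Matrix (ι → Bool) (ι → Bool) ℂ)
    (ρ : Matrix (ι → Bool) (ι → Bool) ℂ) (x : ι → Bool) {s : Fin (d + 1) → ι → Pauli} {i : ι}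
    (hi : s (Fin.last d) i = Pauli.X ∨ s (Fin.last d) i = Pauli.Y) : pathCoeff γ U ρ (proj x) s = 0 := by
  rw [pathCoeff, trace_proj_mul_depolarizeAll_eq_zero γ hi, zero_mul, zero_mul, mul_zero]

/-- **Lemma 5 (second condition, first string)**: if `s_0` has an `X` or `Y` letter, the path contributes
`0` for a basis-state input `|y⟩⟨y|` (the source's `|0ⁿ⟩⟨0ⁿ|`), for any layers, read-out and noise rate.
[cite: AharonovEtAl2023, Lemma 5] -/
theorem pathCoeff_eq_zero_of_first_mem_XY (γ : ℂ) {d : ℕ} (U : Fin d → Matrix (ι → Bool) (ι → Bool) ℂ)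
    (O : Matrix (ι → Bool) (ι → Bool) ℂ) (y : ι → Bool) {s : Fin (d + 1) → ι → Pauli} {i : ι}
    (hi : s 0 i = Pauli.X ∨ s 0 i = Pauli.Y) : pathCoeff γ U (proj y) O s = 0 := by
  rw [pathCoeff, trace_pauliString_mul_proj_eq_zero hi, mul_zero, mul_zero]

/-! ### Lemma 4, items 1–2: the only contributing path of weight `≤ d` is the all-identity path -/

omit [DecidableEq ι] in
/-- A non-identity string has positive Hamming weight. [cite: AharonovEtAl2023, §2 (Hamming weight)] -/
theorem strWeight_pos_of_ne {S : ι → Pauli} (hS : S ≠ fun _ => Pauli.I) : 0 < strWeight S := by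
  rw [strWeight_eq, Finset.card_pos]
  obtain ⟨i, hi⟩ : ∃ i, S i ≠ Pauli.I := by
    by_contra hc
    push Not at hc
    exact hS (funext hc)
  exact ⟨i, Finset.mem_filter.2 ⟨Finset.mem_univ i, hi⟩⟩

omit [DecidableEq ι] in
/-- The identity string is the only string of weight `0`. [cite: AharonovEtAl2023, §2 (proof of Lemma 4: the unique all-identity path)] -/
theorem strWeight_eq_zero_iff {S : ι → Pauli} : strWeight S = 0 ↔ S = fun _ => Pauli.I := by
  constructor
  · intro h
    by_contra hS
    exact absurd h (strWeight_pos_of_ne hS).ne'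
  · rintro rfl
    exact strWeight_const_I

omit [DecidableEq ι] in
/-- In a layer-legal path either every string is the identity or none is.
[cite: AharonovEtAl2023, §2 (proof of Lemma 4)] -/
theorem layerLegal_dichotomy {d : ℕ} {s : Fin (d + 1) → ι → Pauli} (hs : LayerLegal s) :
    (∀ t, s t = fun _ => Pauli.I) ∨ (∀ t, s t ≠ fun _ => Pauli.I) := by
  -- propagate the status of `s 0` along the layers
  have step : ∀ k : ℕ, ∀ hk : k < d + 1, ((s ⟨k, hk⟩ = fun _ => Pauli.I) ↔ (s 0 = fun _ => Pauli.I)) := by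
    intro k
    induction k with
    | zero => intro hk; rfl
    | succ k ih =>
      intro hk
      have hk' : k < d := by omega
      have h := hs ⟨k, hk'⟩
      have e1 : (⟨k, hk'⟩ : Fin d).castSucc = ⟨k, by omega⟩ := rfl
      have e2 : (⟨k, hk'⟩ : Fin d).succ = ⟨k + 1, hk⟩ := rfl
      rw [e1, e2] at h
      exact h.symm.trans (ih (by omega))
  by_cases h0 : s 0 = fun _ => Pauli.I
  · exact Or.inl fun t => (step t.1 t.2).2 h0
  · exact Or.inr fun t ht => h0 ((step t.1 t.2).1 ht)

/-- **Lemma 4, item 2** ("`W_k = 0` for `0 < k ≤ d`"): for unitary layers, a path with a nonzero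
contribution is either the all-identity path (weight `0`) or has every string non-identity, hence
Hamming weight at least `d + 1`. [cite: AharonovEtAl2023, Lemma 4 (items 1–2, proof)] -/
theorem pathWeight_eq_zero_or_lt_of_pathCoeff_ne_zero (γ : ℂ) {d : ℕ}
    {U : Fin d → Matrix (ι → Bool) (ι → Bool) ℂ} (hU : ∀ t, U t ∈ Matrix.unitaryGroup (ι → Bool) ℂ)
    (ρ O : Matrix (ι → Bool) (ι → Bool) ℂ) {s : Fin (d + 1) → ι → Pauli}
    (hs : pathCoeff γ U ρ O s ≠ 0) : pathWeight s = 0 ∨ d < pathWeight s := by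
  have hleg : LayerLegal s := by
    by_contra h
    exact hs (pathCoeff_eq_zero_of_not_layerLegal γ hU ρ O h)
  rcases layerLegal_dichotomy hleg with h | h
  · left
    rw [pathWeight_eq]
    exact Finset.sum_eq_zero fun t _ => strWeight_eq_zero_iff.2 (h t)
  · right
    rw [pathWeight_eq]
    calc d < d + 1 := Nat.lt_succ_self d
      _ = ∑ _t : Fin (d + 1), 1 := by simp
      _ ≤ ∑ t : Fin (d + 1), strWeight (s t) :=
          Finset.sum_le_sum fun t _ => strWeight_pos_of_ne (h t)

/-- `Tr |x⟩⟨x| = 1`. [cite: AharonovEtAl2023, §2 (Table 1: ⟨⟨x|x⟩⟩ = 1)] -/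
theorem trace_proj (x : ι → Bool) : (proj x).trace = 1 := by
  rw [← Matrix.mul_one (proj x), trace_proj_mul, Matrix.one_apply_eq]

/-- `Tr 1 = 2^{|ι|}` on the register. [folklore] -/
private theorem trace_one_reg' :
    (1 : Matrix (ι → Bool) (ι → Bool) ℂ).trace = (2 : ℂ) ^ Fintype.card ι := by
  rw [Matrix.trace_one, Fintype.card_fun, Fintype.card_bool]
  push_cast
  rfl

/-- **Lemma 4, item 1** ("`W_0 = 1` corresponds to the unique all-identity path"): for unitary layers,
basis-state input `|y⟩⟨y|` and read-out `|x⟩⟨x|`, the all-identity path contributes exactly `2^{-|ι|}`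
(the uniform distribution), at every noise rate. [cite: AharonovEtAl2023, Lemma 4 (item 1, proof)] -/
theorem pathCoeff_const_I_proj (γ : ℂ) {d : ℕ} {U : Fin d → Matrix (ι → Bool) (ι → Bool) ℂ}
    (hU : ∀ t, U t ∈ Matrix.unitaryGroup (ι → Bool) ℂ) (x y : ι → Bool) :
    pathCoeff γ U (proj y) (proj x) (fun _ _ => Pauli.I) = ((2 : ℂ) ^ Fintype.card ι)⁻¹ := by
  have hUU : ∀ t, U t * (U t)ᴴ = 1 := fun t => by
    simpa only [star_eq_conjTranspose] using Matrix.mem_unitaryGroup_iff.mp (hU t)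
  have hE1 : depolarizeAll γ (1 : Matrix (ι → Bool) (ι → Bool) ℂ) = 1 := by
    have h := depolarizeAll_pauliString γ (fun _ : ι => Pauli.I)
    rwa [strWeight_const_I, pow_zero, one_smul, pauliString_const_I] at h
  have hamp : ∀ t : Fin d, transAmp γ (U t) (fun _ => Pauli.I) (fun _ => Pauli.I) =
      (2 : ℂ) ^ Fintype.card ι := by
    intro t
    rw [transAmp, pauliString_const_I, hE1, Matrix.one_mul, Matrix.mul_one, hUU, trace_one_reg']
  simp only [pathCoeff, hamp, Finset.prod_const, Finset.card_univ, Fintype.card_fin,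
    pauliString_const_I, hE1, trace_proj, one_mul, mul_one]
  rw [pow_succ, inv_pow]
  field_simp

/-- Hence the weight-`0` Fourier weight is `1`: `2^{2n} f(C, I…I, x)² = 1` (Definition 5 with the single
all-identity path). [cite: AharonovEtAl2023, Definition 5 and Lemma 4 (item 1)] -/
theorem fourierWeight_zero (γ : ℂ) {d : ℕ} {U : Fin d → Matrix (ι → Bool) (ι → Bool) ℂ}
    (hU : ∀ t, U t ∈ Matrix.unitaryGroup (ι → Bool) ℂ) (x y : ι → Bool) :
    ((2 : ℂ) ^ Fintype.card ι) ^ 2 * pathCoeff γ U (proj y) (proj x) (fun _ _ => Pauli.I) ^ 2 = 1 := by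
  rw [pathCoeff_const_I_proj γ hU x y, inv_pow, mul_inv_cancel₀]
  exact pow_ne_zero _ (pow_ne_zero _ two_ne_zero)

/-! ### Counting Pauli paths by Hamming weight (§3.2, "a simple argument for bounding the number of paths")

"There are `n(d+1)` locations in the circuit to insert Pauli paths. The total number of ways to insert
`ℓ` non-identity Pauli into the Pauli path is at most `binom(n(d+1), ℓ)`, and the choice of `X,Y,Z` for
each non-identity gives a `3^ℓ` factor."  Below: the EXACT number of functions on an `N`-element set
with exactly `k` non-default values is `binom(N,k)·(|A|−1)^k` (`card_filter_weight_eq`), whence the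
number of Pauli paths of Hamming weight `k` is `binom(n(d+1), k)·3^k` (`card_filter_pathWeight_eq`);
the number of terms of the truncated sum `q̄ = Σ_{|s|≤ℓ}` is therefore `Σ_{k≤ℓ} binom(n(d+1),k) 3^k`
(`card_filter_pathWeight_le`), the `(nd)^{O(ℓ)}` of the quasi-polynomial algorithm. -/

section Counting

variable {P A : Type*} [Fintype P] [DecidableEq P] [Fintype A] [DecidableEq A]

omit [Fintype ι] [DecidableEq ι] in
/-- The support (non-default positions) of a function. [folklore] -/
private def supp (a₀ : A) (f : P → A) : Finset P := Finset.univ.filter fun p => f p ≠ a₀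

omit [Fintype ι] [DecidableEq ι] in
/-- Functions with a prescribed support `S` correspond to functions `S → {a ≠ a₀}`. [folklore] -/
private def suppEquiv (a₀ : A) (S : Finset P) :
    {f : P → A // supp a₀ f = S} ≃ (S → {a : A // a ≠ a₀}) where
  toFun f := fun p => ⟨f.1 p, by
    have h : (p : P) ∈ supp a₀ f.1 := by rw [f.2]; exact p.2
    simpa [supp] using h⟩
  invFun g := ⟨fun p => if h : p ∈ S then (g ⟨p, h⟩).1 else a₀, by
    ext p
    simp only [supp, Finset.mem_filter, Finset.mem_univ, true_and]
    constructor
    · intro h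
      by_contra hp
      exact h (by rw [dif_neg hp])
    · intro hp
      rw [dif_pos hp]
      exact (g ⟨p, hp⟩).2⟩
  left_inv f := by
    apply Subtype.ext
    funext p
    simp only
    split_ifs with h
    · rfl
    · have hp : p ∉ supp a₀ f.1 := by rw [f.2]; exact h
      simp only [supp, Finset.mem_filter, Finset.mem_univ, true_and, not_not] at hp
      exact hp.symm
  right_inv g := by
    funext p
    apply Subtype.ext
    simp only [dif_pos p.2]

omit [Fintype ι] [DecidableEq ι] in
/-- The number of functions with support exactly `S` is `(|A| − 1)^{|S|}`. [folklore] -/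
private theorem card_filter_supp_eq (a₀ : A) (S : Finset P) :
    (Finset.univ.filter fun f : P → A => supp a₀ f = S).card = (Fintype.card A - 1) ^ S.card := by
  have h := Fintype.card_congr (suppEquiv a₀ S)
  rw [Fintype.card_fun, Fintype.card_subtype_compl, Fintype.card_subtype_eq, Fintype.card_coe] at h
  rw [← h, Fintype.card_subtype]

omit [Fintype ι] [DecidableEq ι] in
/-- **Exact count**: the number of functions `f : P → A` taking a non-default value at exactly `k` of the
`N = |P|` positions is `binom(N,k)·(|A|−1)^k` (choose the positions, then the non-default letters).
[cite: AharonovEtAl2023, §3.2 (first paragraph: "n(d+1) locations … binom … 3^ℓ factor")] -/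
theorem card_filter_weight_eq (a₀ : A) (k : ℕ) :
    (Finset.univ.filter fun f : P → A => (Finset.univ.filter fun p => f p ≠ a₀).card = k).card =
      (Fintype.card P).choose k * (Fintype.card A - 1) ^ k := by
  have H : ∀ f ∈ (Finset.univ.filter fun f : P → A => (supp a₀ f).card = k),
      supp a₀ f ∈ (Finset.univ : Finset P).powersetCard k := fun f hf =>
    Finset.mem_powersetCard.2 ⟨Finset.subset_univ _, (Finset.mem_filter.1 hf).2⟩
  change (Finset.univ.filter fun f : P → A => (supp a₀ f).card = k).card = _
  rw [Finset.card_eq_sum_card_fiberwise H]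
  calc ∑ S ∈ (Finset.univ : Finset P).powersetCard k,
        ((Finset.univ.filter fun f : P → A => (supp a₀ f).card = k).filter fun f => supp a₀ f = S).card
      = ∑ S ∈ (Finset.univ : Finset P).powersetCard k, (Fintype.card A - 1) ^ k := by
        refine Finset.sum_congr rfl fun S hS => ?_
        have hSk : S.card = k := (Finset.mem_powersetCard.1 hS).2
        rw [Finset.filter_filter, ← hSk, ← card_filter_supp_eq a₀ S]
        congr 1
        ext f
        simp only [Finset.mem_filter, Finset.mem_univ, true_and]
        exact ⟨fun h => h.2, fun h => ⟨by rw [h], h⟩⟩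
    _ = (Fintype.card P).choose k * (Fintype.card A - 1) ^ k := by
        rw [Finset.sum_const, Finset.card_powersetCard, Finset.card_univ, smul_eq_mul]

end Counting

omit [DecidableEq ι] in
/-- The Hamming weight of a path is the number of its non-identity (layer, wire) positions.
[cite: AharonovEtAl2023, §2 (Hamming weight of a path)] -/
theorem pathWeight_eq_card {d : ℕ} (s : Fin (d + 1) → ι → Pauli) :
    pathWeight s = (Finset.univ.filter fun p : Fin (d + 1) × ι => s p.1 p.2 ≠ Pauli.I).card := by
  rw [pathWeight_eq, Finset.card_filter, Fintype.sum_prod_type]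
  exact Finset.sum_congr rfl fun t _ => by rw [strWeight_eq, Finset.card_filter]

/-- **The number of Pauli paths of Hamming weight `k` is `binom(n(d+1), k)·3^k`** (`n(d+1)` locations,
three non-identity letters each). [cite: AharonovEtAl2023, §3.2 (first paragraph)] -/
theorem card_filter_pathWeight_eq (d k : ℕ) :
    (Finset.univ.filter fun s : Fin (d + 1) → ι → Pauli => pathWeight s = k).card =
      (Fintype.card ι * (d + 1)).choose k * 3 ^ k := by
  classical
  have h := card_filter_weight_eq (P := Fin (d + 1) × ι) Pauli.I k
  rw [Fintype.card_prod, Fintype.card_fin, Pauli.card_univ, mul_comm (d + 1)] at h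
  rw [← h]
  refine Finset.card_equiv (Equiv.curry (Fin (d + 1)) ι Pauli).symm fun s => ?_
  simp only [Finset.mem_filter, Finset.mem_univ, true_and, pathWeight_eq_card]
  rfl

/-- **Number of terms of the truncated sum**: the Pauli paths of Hamming weight at most `ℓ` number
`Σ_{k ≤ ℓ} binom(n(d+1), k)·3^k` ("the total number of paths with Hamming weight at most `ℓ` is at most
`… ≤ (nd)^{O(ℓ)}`", the quasi-polynomial count). [cite: AharonovEtAl2023, §3.2 (first paragraph and its display)] -/
theorem card_filter_pathWeight_le (d ℓ : ℕ) :
    (Finset.univ.filter fun s : Fin (d + 1) → ι → Pauli => pathWeight s ≤ ℓ).card =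
      ∑ k ∈ Finset.range (ℓ + 1), (Fintype.card ι * (d + 1)).choose k * 3 ^ k := by
  classical
  have H : ∀ s ∈ (Finset.univ.filter fun s : Fin (d + 1) → ι → Pauli => pathWeight s ≤ ℓ),
      pathWeight s ∈ Finset.range (ℓ + 1) := fun s hs =>
    Finset.mem_range.2 (Nat.lt_succ_of_le (Finset.mem_filter.1 hs).2)
  rw [Finset.card_eq_sum_card_fiberwise H]
  refine Finset.sum_congr rfl fun k hk => ?_
  rw [Finset.filter_filter, ← card_filter_pathWeight_eq d k]
  congr 1
  ext s
  simp only [Finset.mem_filter, Finset.mem_univ, true_and]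
  exact ⟨fun h => h.2, fun h => ⟨h ▸ Nat.le_of_lt_succ (Finset.mem_range.1 hk), h⟩⟩

end PauliPath

end Literature.Computability.QuantumComplexity
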